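import Literature.AlgebraicGeometry.Limits.RationalFunctions
import HarnessLib

/-!
# Limits of schemes: every Cartier divisor on the limit comes from a finite stage
# (The Stacks Project, Lemma 0B8W (2); Görtz–Wedhorn I, Thm. 10.60, Exercise 10.33)

Topic: `Literature/AlgebraicGeometry/Limits`. For a limit `c.pt = lim_i D i` of a cofiltered thin
diagram of integral quasi-compact quasi-separated schemes with affine dominant transition maps and
dominant projections `π_i` (`Limits/RationalFunctions`; e.g. the cones `SubalgApprox.prodCone` of
`Limits/SubalgebraDiagram`), this file proves the **surjectivity half of
`Pic(lim D i) = colim Pic(D i)`** in the divisor language of `Motives/CartierDivisor` — indeed for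
divisors themselves, not only for their classes:

* `exists_chartData` — every Cartier divisor `D'` on the limit is presented by finitely many
  charts `π_i⁻¹V_a`, `V_a` non-empty affine opens of ONE stage `D i`, with local equations
  `π_i^♯ e_a` pulled back from that stage (Mathlib `isBasis_preimage_isAffineOpen`,
  `Scheme.compactSpace_of_isLimit`; `exists_functionFieldMap_π_eq` of `Limits/RationalFunctions`);
* `exists_stage_cocycle` — the cocycle conditions "`e_a / e_b` is a unit on `V_a ∩ V_b`", true
  after `π_i^♯` on the limit, hold on some finer stage (`exists_forall_isUnitAt_functionFieldMap`
  on the quasi-compact `V_a ∩ V_b`, Mathlib `IsCompact.inter_of_isOpen`), where moreover the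
  `V_a` cover (Mathlib `exists_map_eq_top`);
* `exists_sameDivisor_pullback_π` — hence **`D'` is, as a divisor (`CartierDivisor.SameDivisor`),
  the pullback `π_j^* E` of a Cartier divisor `E` on some stage `D j`.** This is The Stacks
  Project, Lemma 0B8W (2) ("any invertible `𝒪_S`-module is the pullback of an invertible
  `𝒪_{S_i}`-module for some `i`") for integral schemes, where invertible modules are Cartier
  divisor classes (Görtz–Wedhorn I, Prop. 11.21); Görtz–Wedhorn I, Thm. 10.60 (1) / Exercise 10.33.

It is the ingredient "`𝒪(D)` descends to some `λ₀`" of `theoremOfCube_noetherianDescent`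
(`Motives/TheoremOfCubeLimit`) and of `cartierDivisor_prod_noetherianDescent`
(`Motives/GrothendieckComplexFieldPoints`). Mathlib searched (pin): `exists_map_eq_top`,
`isBasis_preimage_isAffineOpen`, `Scheme.compactSpace_of_isLimit`, `IsCompact.inter_of_isOpen`,
`Scheme.Hom.preimage_iSup`, `CompactSpace.elim_nhds_subcover`, `IsCofiltered.inf_objs_exists`
(used); no `Pic` of a limit in Mathlib.

## References

* The Stacks Project, Tag 01YT (Limits of schemes): Lemma 0B8W (2), Lemma 01Z4. [StacksProject]
* U. Görtz, T. Wedhorn, *Algebraic Geometry I: Schemes*, 2nd ed. (2020): Thm. 10.57, p. 325;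
  Thm. 10.60, p. 326; Exercise 10.33, p. 353; Prop. 11.21, p. 374 (read via the held copy).
  [GortzWedhorn2020]
-/

universe u

open CategoryTheory CategoryTheory.Limits AlgebraicGeometry TopologicalSpace Opposite
open Literature.AlgebraicGeometry.Motives Literature.AlgebraicGeometry.Motives.RatFn

noncomputable section

namespace Literature.AlgebraicGeometry.Limits

set_option backward.isDefEq.respectTransparency false

variable {I : Type u} [Category.{u} I] [IsCofiltered I] [Quiver.IsThin I] (D : I ⥤ Scheme.{u})
  (c : Cone D) (hc : IsLimit c) [∀ {i j : I} (f : i ⟶ j), IsAffineHom (D.map f)]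
  [∀ i, IsIntegral (D.obj i)] [IsIntegral c.pt] [∀ i, IsDominant (proj D c i)]
  [∀ {i j : I} (f : i ⟶ j), IsDominant (D.map f)] [∀ i, CompactSpace (D.obj i)]
  [∀ i, QuasiSeparatedSpace (D.obj i)]

omit [Quiver.IsThin I] [∀ i, QuasiSeparatedSpace (D.obj i)] in
include hc in
/-- **Charts and equations from one stage.** Every Cartier divisor `D'` on the limit is presented
— up to `SameDivisor` — by finitely many charts `π_i⁻¹V_a` with `V_a ⊆ D i` non-empty affine
opens of one stage `i`, and local equations `π_i^♯ e_a`, `e_a ∈ K(D i)^×`: the preimages of affine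
opens of the stages form a basis of the (quasi-compact) limit (Mathlib
`isBasis_preimage_isAffineOpen`, `Scheme.compactSpace_of_isLimit`), rational functions on the limit
come from a stage (`exists_functionFieldMap_π_eq`), and finitely many stages have a common
refinement. The last clause says that `(π_i⁻¹V_a, π_i^♯ e_a)` and `D'` define the same divisor.
[folklore] -/
theorem exists_chartData (D' : CartierDivisor c.pt) :
    ∃ (i : I) (s : Type u) (_ : Finite s) (V : s → (D.obj i).Opens)
      (e : s → (D.obj i).functionField),
      (∀ a, IsAffineOpen (V a) ∧ (V a : Set (D.obj i)).Nonempty ∧ e a ≠ 0) ∧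
      (∀ x : c.pt, ∃ a, x ∈ proj D c i ⁻¹ᵁ V a) ∧
      (∀ a q (x : c.pt), x ∈ proj D c i ⁻¹ᵁ V a → x ∈ D'.U q →
        IsUnitAt x (functionFieldMap (proj D c i) (e a) / D'.f q)) := by
  classical
  haveI : CompactSpace c.pt := Scheme.compactSpace_of_isLimit D c hc
  -- pointwise: a chart `U_p ∋ x`, a basic open `π_k⁻¹V ∋ x` inside it, and `f_p = π_k^♯ e`
  have H : ∀ x : c.pt, ∃ (p : D'.ι) (k : I) (V : (D.obj k).Opens) (e : (D.obj k).functionField),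
      IsAffineOpen V ∧ x ∈ proj D c k ⁻¹ᵁ V ∧ (∀ y, y ∈ proj D c k ⁻¹ᵁ V → y ∈ D'.U p) ∧
      functionFieldMap (proj D c k) e = D'.f p := by
    intro x
    obtain ⟨p, hp⟩ := D'.covers x
    obtain ⟨_, ⟨W, hWB, rfl⟩, hxW, hWU⟩ :=
      (isBasis_preimage_isAffineOpen D c hc).exists_subset_of_mem_open hp (D'.U p).isOpen
    obtain ⟨i₁, V, hV, rfl⟩ := hWB
    replace hxW : x ∈ proj D c i₁ ⁻¹ᵁ V := hxW
    replace hWU : ∀ y, y ∈ proj D c i₁ ⁻¹ᵁ V → y ∈ D'.U p := fun y hy => hWU hy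
    obtain ⟨i₂, e₂, he₂⟩ := exists_functionFieldMap_π_eq D c hc (D'.f p)
    let k := IsCofiltered.min i₁ i₂
    have e1 : proj D c k ⁻¹ᵁ D.map (IsCofiltered.minToLeft i₁ i₂) ⁻¹ᵁ V = proj D c i₁ ⁻¹ᵁ V := by
      rw [← Scheme.Hom.comp_preimage, proj_comp]
    refine ⟨p, k, D.map (IsCofiltered.minToLeft i₁ i₂) ⁻¹ᵁ V,
      functionFieldMap (D.map (IsCofiltered.minToRight i₁ i₂)) e₂, hV.preimage _, ?_, ?_, ?_⟩
    · rw [e1]; exact hxW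
    · intro y hy; rw [e1] at hy; exact hWU y hy
    · rw [← RingHom.comp_apply, ← functionFieldMap_comp,
        SubalgApprox.functionFieldMap_congr (proj_comp D c _)]
      exact he₂
  choose p k V e hV hxV hVU he using H
  -- finitely many points suffice
  obtain ⟨s, hs⟩ := CompactSpace.elim_nhds_subcover (fun x => ((proj D c (k x) ⁻¹ᵁ V x :
    c.pt.Opens) : Set c.pt)) (fun x => (proj D c (k x) ⁻¹ᵁ V x).isOpen.mem_nhds (hxV x))
  -- a common stage `i₀` below the `k x`, `x ∈ s`
  obtain ⟨i₀, hi₀⟩ := IsCofiltered.inf_objs_exists (s.image k)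
  have m : ∀ a : ↥s, i₀ ⟶ k a.1 := fun a => (hi₀ (Finset.mem_image_of_mem k a.2)).some
  have e2 : ∀ a : ↥s, proj D c i₀ ⁻¹ᵁ D.map (m a) ⁻¹ᵁ V a.1 = proj D c (k a.1) ⁻¹ᵁ V a.1 :=
    fun a => by rw [← Scheme.Hom.comp_preimage, proj_comp]
  have e3 : ∀ a : ↥s, functionFieldMap (proj D c i₀) (functionFieldMap (D.map (m a)) (e a.1)) =
      D'.f (p a.1) := fun a => by
    rw [← RingHom.comp_apply, ← functionFieldMap_comp,
      SubalgApprox.functionFieldMap_congr (proj_comp D c _)]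
    exact he a.1
  refine ⟨i₀, ↥s, inferInstance, fun a => D.map (m a) ⁻¹ᵁ V a.1,
    fun a => functionFieldMap (D.map (m a)) (e a.1), fun a => ⟨(hV a.1).preimage _, ?_, ?_⟩,
    fun x => ?_, fun a q x ha hq => ?_⟩
  · refine ⟨proj D c i₀ a.1, ?_⟩
    change a.1 ∈ proj D c i₀ ⁻¹ᵁ D.map (m a) ⁻¹ᵁ V a.1
    rw [e2]
    exact hxV a.1
  · intro h0
    have h0' : functionFieldMap (D.map (m a)) (e a.1) = 0 := h0
    apply D'.f_ne_zero (p a.1)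
    rw [← e3, h0', map_zero]
  · have hx : x ∈ ⋃ y ∈ s, ((proj D c (k y) ⁻¹ᵁ V y : c.pt.Opens) : Set c.pt) := by
      rw [hs]; exact Set.mem_univ x
    obtain ⟨y, hy, hxy⟩ := Set.mem_iUnion₂.mp hx
    refine ⟨⟨y, hy⟩, ?_⟩
    rw [e2]
    exact hxy
  · rw [e3]
    rw [e2] at ha
    exact D'.isUnitAt_div (p a.1) q x (hVU a.1 x ha) hq

include hc in
/-- **The cocycles hold, and the charts cover, on a finer stage.** Given finitely many affine opens
`V_a` of the stage `D i` whose preimages cover the limit and rational functions `e_a` with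
`π_i^♯(e_a / e_b)` a unit on `π_i⁻¹(V_a ∩ V_b)`, there is a finer stage `f : j → i` on which the
`(D f)⁻¹V_a` cover (Mathlib `exists_map_eq_top`) and `(D f)^♯(e_a / e_b)` is a unit on
`(D f)⁻¹(V_a ∩ V_b)` for all `a, b` (`exists_forall_isUnitAt_functionFieldMap` on the quasi-compact
opens `V_a ∩ V_b`, Mathlib `IsCompact.inter_of_isOpen`; a common refinement of the finitely many
stages, the diagram being thin). [folklore] -/
theorem exists_stage_cocycle {i : I} {s : Type u} [Finite s] (V : s → (D.obj i).Opens)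
    (e : s → (D.obj i).functionField) (hV : ∀ a, IsAffineOpen (V a))
    (hcov : ∀ x : c.pt, ∃ a, x ∈ proj D c i ⁻¹ᵁ V a)
    (hcoc : ∀ a b (x : c.pt), x ∈ proj D c i ⁻¹ᵁ V a → x ∈ proj D c i ⁻¹ᵁ V b →
      IsUnitAt x (functionFieldMap (proj D c i) (e a) / functionFieldMap (proj D c i) (e b))) :
    ∃ (j : I) (f : j ⟶ i), (∀ y : D.obj j, ∃ a, y ∈ D.map f ⁻¹ᵁ V a) ∧
      ∀ a b (y : D.obj j), y ∈ D.map f ⁻¹ᵁ V a → y ∈ D.map f ⁻¹ᵁ V b →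
        IsUnitAt y (functionFieldMap (D.map f) (e a) / functionFieldMap (D.map f) (e b)) := by
  classical
  -- each cocycle condition descends to some stage
  have step : ∀ ab : s × s, ∃ (j : I) (f : j ⟶ i),
      ∀ y ∈ D.map f ⁻¹ᵁ (V ab.1 ⊓ V ab.2),
        IsUnitAt y (functionFieldMap (D.map f) (e ab.1 / e ab.2)) := by
    rintro ⟨a, b⟩
    rcases ((V a ⊓ V b : (D.obj i).Opens) : Set (D.obj i)).eq_empty_or_nonempty with h0 | hne
    · refine ⟨i, 𝟙 i, fun y hy => ?_⟩
      exfalso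
      have hy' : y ∈ ((V a ⊓ V b : (D.obj i).Opens) : Set (D.obj i)) := by
        rw [D.map_id] at hy
        exact hy
      rw [h0] at hy'
      exact hy'
    · refine exists_forall_isUnitAt_functionFieldMap D c hc
        ((hV a).isCompact.inter_of_isOpen (hV b).isCompact (V a).isOpen (V b).isOpen) hne ?_
      intro w hw
      rw [map_div₀]
      exact hcoc a b w hw.1 hw.2
  choose j f hj using step
  -- the charts cover some stage
  have hW : proj D c i ⁻¹ᵁ (⨆ a, V a) = ⊤ := by
    apply top_le_iff.mp
    intro x _
    rw [Scheme.Hom.preimage_iSup]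
    exact Opens.mem_iSup.mpr (hcov x)
  obtain ⟨j₀, f₀, hj₀⟩ := exists_map_eq_top D c hc (⨆ a, V a) hW
  -- a common refinement `m` of `j₀` and the `j ab`
  haveI : Fintype (s × s) := Fintype.ofFinite _
  obtain ⟨m, hm⟩ := IsCofiltered.inf_objs_exists (insert j₀ (Finset.univ.image j))
  obtain ⟨u₀⟩ := hm (Finset.mem_insert_self j₀ _)
  have n : ∀ ab, m ⟶ j ab := fun ab =>
    (hm (Finset.mem_insert_of_mem (Finset.mem_image_of_mem j (Finset.mem_univ ab)))).some
  have hF : ∀ ab, u₀ ≫ f₀ = n ab ≫ f ab := fun ab => Subsingleton.elim _ _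
  refine ⟨m, u₀ ≫ f₀, fun y => ?_, fun a b y ha hb => ?_⟩
  · have hy : D.map u₀ y ∈ D.map f₀ ⁻¹ᵁ ⨆ a, V a := by rw [hj₀]; trivial
    rw [Scheme.Hom.preimage_iSup] at hy
    obtain ⟨a, ha⟩ := Opens.mem_iSup.mp hy
    refine ⟨a, ?_⟩
    rw [D.map_comp, Scheme.Hom.comp_preimage]
    exact ha
  · have hy : D.map (n (a, b)) y ∈ D.map (f (a, b)) ⁻¹ᵁ (V a ⊓ V b) := by
      rw [hF (a, b), D.map_comp, Scheme.Hom.comp_preimage] at ha hb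
      exact ⟨ha, hb⟩
    have h2 := (hj (a, b) _ hy).functionFieldMap (f := D.map (n (a, b)))
    rw [← RingHom.comp_apply, ← functionFieldMap_comp] at h2
    rw [SubalgApprox.functionFieldMap_congr ((congrArg D.map (hF (a, b))).trans (D.map_comp _ _)),
      ← map_div₀]
    exact h2

include hc in
/-- **Every Cartier divisor on the limit comes from a finite stage** (surjectivity of
`colim_i Div(D i) → Div(lim_i D i)`, hence of `colim Pic(D i) → Pic(lim D i)`; The Stacks Project,
Lemma 0B8W (2): "any invertible `𝒪_S`-module is the pullback of an invertible `𝒪_{S_i}`-module for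
some `i`", for integral schemes where invertible modules are divisor classes, Görtz–Wedhorn I,
Prop. 11.21; Thm. 10.60 (1), Exercise 10.33): for a cofiltered thin diagram of quasi-compact
quasi-separated integral schemes with affine dominant transition maps, an integral limit with
dominant projections `π_i`, and a Cartier divisor `D'` on the limit, there are a stage `j` and a
Cartier divisor `E` on `D j` such that `D'` and `π_j^* E` define the same divisor. [folklore] -/
theorem exists_sameDivisor_pullback_π (D' : CartierDivisor c.pt) :
    ∃ (j : I) (E : CartierDivisor (D.obj j)), D'.SameDivisor (E.pullback (proj D c j)) := by
  obtain ⟨i, s, hs, V, e, hVe, hcov, hR⟩ := exists_chartData D c hc D'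
  haveI := hs
  -- the cocycle conditions on the limit follow from the comparison with `D'`
  have hcoc : ∀ a b (x : c.pt), x ∈ proj D c i ⁻¹ᵁ V a → x ∈ proj D c i ⁻¹ᵁ V b →
      IsUnitAt x (functionFieldMap (proj D c i) (e a) / functionFieldMap (proj D c i) (e b)) := by
    intro a b x ha hb
    obtain ⟨q, hq⟩ := D'.covers x
    have h1 := (hR a q x ha hq).mul (hR b q x hb hq).inv
    rwa [inv_div, div_mul_div_cancel₀ (D'.f_ne_zero q)] at h1
  obtain ⟨j, f, hcov', hcoc'⟩ := exists_stage_cocycle D c hc V e (fun a => (hVe a).1) hcov hcoc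
  refine ⟨j, { ι := s
               U := fun a => D.map f ⁻¹ᵁ V a
               covers := hcov'
               f := fun a => functionFieldMap (D.map f) (e a)
               f_ne_zero := fun a => (map_ne_zero _).2 (hVe a).2.2
               isUnitAt_div := hcoc' }, fun q a x hq ha => ?_⟩
  change x ∈ proj D c j ⁻¹ᵁ D.map f ⁻¹ᵁ V a at ha
  rw [← Scheme.Hom.comp_preimage, proj_comp] at ha
  have h1 := (hR a q x ha hq).inv
  rw [inv_div] at h1
  change IsUnitAt x (D'.f q / functionFieldMap (proj D c j) (functionFieldMap (D.map f) (e a)))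
  rwa [← RingHom.comp_apply, ← functionFieldMap_comp,
    SubalgApprox.functionFieldMap_congr (proj_comp D c f)]

end Literature.AlgebraicGeometry.Limits

end
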